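/-
Copyright (c) 2026 the pub-hodgecm-mathlib formalisation cell (harness21).  Prover seat hodgecm-mathlib-LH4-p04 (g2), req620 Track A «(D-RAM) FOUR-FRAME» squad
(unit U3_Laws, (R-22) «κS-RECUT»: THE Ω DEFS LEAF — the norm-residue sign of the `F`-germ of a norm-one unit; heir LEAD T18-50 (d1), pen∕dealer LH4-plan (g12) WORD #1 (4)(i) ∕
WORD #2 (2), SHAPE MEMO v1 `F0/P3c/LH4/LH4-plan/g11/KS-RECUT-SHAPE-MEMO.v1` 668606e9 Q1 OPTION A, REF5 (g22) R5-115 (2) «symmetric units (b, a, b∕a), junk := 1»).  2026-09-04.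
-/
import Literature.NumberTheory.Automorphic.UnitaryThreeFourFrameDefs   -- ★ #0a (B-p04): `normSign` (the norm-class sign `ω`), `IsRamifiedQuadraticDatum`
import HarnessLib

/-!
# Crux `H413`, line LH4 «(D-RAM) FOUR-FRAME» road — unit U3_Laws (iii), (R-22) «κS-RECUT»: DEFS LEAF «THE GLUE SIGN `Ω`»
# (two definitions + `rfl` ties and the two evaluation identities that need no valuation theory; no theorem content about the laws)

Cell `hodgecm-mathlib` (D-0151), FLOOR 0, crux item H413 = `stmt-HodgeConjecture-24833`, route of record `HCCMUnconditional`; squad F0∕P3c∕LH4 (req618∕req620); registered stubs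
concerned: the κS leaves of `Cruxes/H413/Lines/F0_P3c_DyRamFourFrame_U3_Laws.lean` ((κS-B₀)∕(κS-B₂) ED. 10 :509∕:524, UNDER (R-22) PAPER REFUTATION as ∀-K statements at data
with `d` even, `t∕2 + 2 ≤ d ≤ t − 2` — REF5 (g22) R5-109 (3), LH4-r01 (g4) GD∕GM, LHref-N #343) and their Ω-aware re-letter (κS-B₀²)∕(κS-B₂²)∕KSS²∕K-SGN-R2 (SHAPE MEMO v1 §2).
DEFINITIONS ONLY (no instance, no notation, no `sorry`, no theorem asserting anything about `U(3)`); lane `--supports stmt-HodgeConjecture-24833` (count-neutral).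
Precedents: ★ DEFS leaves `F0P3cDyRamDiagonalTorusDefs`, `…StrataDefs`, `…KappaCountDefs`.

WHY A DEFS LEAF.  On a glue shell the κ-Stage-B table carries the sign `ω(f₀)` of a σ-FIXED glue witness `f₀` approximating a NORM-ONE unit `c ∈ {b∕a, b, a}` (up to a
fixed `F`-part, ★ `…KappaSignDictionary`): `ω(f₀) = ω(u)·(law token)` for ANY fixed `u` with `u ≡ c` modulo `U_E^{(2d−1)}` (★ `…KappaSignDictionaryRecut` (R0)(R1)(R2)).  The factor
`ω(u)` depends on `c` only — `F ∩ U_E^{(2d−1)} = U_F^{(d)} ⊆ N(E^×)`, the conductor of `E∕F` being `𝔭_F^d` (★ deep norms; ★ `normSign_eq_of_near`) — and is `+1` whenever `c`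
itself is within `U_E^{(2d−1)}` of `1` (every place of record: REF5 R5-114∕115 «`d` odd ∨ `2d ≤ t + 2`»), but it is `−1` on admissible data at `(d,t) = (6,8)` (LH4-r01 (g4) GD)
and at e2b `(4,4)` type 2 (REF5 R5-114, LH4-r01 GM).  The re-lettered laws therefore carry the token `Ω(c_i)`, `(c₀, c₁, c₂) = (b, a, b∕a) = (l₁∕l₂, l₀∕l₂, l₁∕l₀)` for
`l = (a, b, 1)` (the SYMMETRIC units of REF5 R5-115 (2); `≡ (b, b²∕a, b∕a)` of LH4-p05 (g3) since `Ω` is multiplicative), and this leaf gives that token a NAME.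

CONTENTS (`K : Type`, `[Field K] [Valued K ℤᵐ⁰]` only — NO `[CompleteSpace K]`, NO `[Fintype 𝓀[K]]` in the definitions, so that `glueSignR` inhabits LH4-p10 (g3)'s schedule type
`∀ {K : Type} [Field K] [Valued K ℤᵐ⁰], (K →+* K) → K → ℕ → K → K → Fin 3 → ℤ` (REF5 R5-116 (a)); completeness belongs to the LEMMAS of the sequel `…DiagonalGlueSignEval`).
§1 `IsGlueRep σ ϖ d w u` — «`u` is a σ-fixed unit representative of `w` modulo `U_E^{(2d−1)}`»: `σ u = u ∧ |u| = 1 ∧ |w − u| ≤ |ϖ|^{2d−1}` (the binder shape of ★ Recut (R0)(R2)).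
§2 `glueSign σ ϖ d w : ℤ` — OPTION A WITH JUNK `1`, CHOICE-FREE: `−1` if `w` HAS a representative and some representative is a non-norm, else `1`.  (So: no representative ⇒
`1`; a representative `u` ⇒ `= normSign σ u`, the independence of `u` being the sequel's theorem `glueSign_eq_normSign`.)  JUNK IS NEVER READ: where no representative exists the
amplitude of that axis vanishes (REF5 R5-115 (2), REF1 m15 (2): `ampl q k B = 0` for `B ≤ 0`, sequel `ampl_eq_zero_of_nonpos`).
§3 `glueSignR σ ϖ d a b i := glueSign σ ϖ d (![b, a, b ∕ a] i)` — THE TOKEN OF RECORD `ΩR` (the pen's name; spelled `glueSignR` as a Lean identifier), slot `i` of the square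
datum `(a, b)`.  §4 `rfl` ∕ `Iff.rfl` ties and the two definitional evaluations (`= 1` without a representative; the slot table of `glueSignR`).
HONEST LABEL.  Count-neutral vehicle; defines, asserts nothing; the κS laws stay PROVER TARGETS under (R-22) review; `HC_CM` is proved only modulo the 7 printed citations (2 remaining
named inputs: hLiu418 = `stmt-HodgeConjecture-24832`, h413 = `stmt-HodgeConjecture-24833`) until rung 0 closes.

## References
* [Serre1979] J.-P. Serre, *Local Fields*, GTM 67 (1979), Ch. V §3 Prop. 5, Cor. 3 (the conductor of a ramified quadratic extension: `U_F^{(d)} ⊆ N`), Ch. XV §2 (the norm-residue symbol).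
* [Rogawski1990] J. D. Rogawski, *Automorphic Representations of Unitary Groups in Three Variables*, Ann. of Math. Stud. 123 (1990), §4.9 p. 55, §4.10 p. 58 (the κ-signs).
* [LanglandsShelstad1987] R. P. Langlands, D. Shelstad, *On the definition of transfer factors*, Math. Ann. 278 (1987), §3 (κ as a character).
-/

set_option autoImplicit false

noncomputable section

namespace Summit.HodgeConjecture.HodgeConjecture.Cruxes.H413.F0P3cDyRamDiagonalGlueSignDefs

open Literature.NumberTheory.Automorphic Literature.NumberTheory.Automorphic.UnitaryThreeFourFrame
open scoped Valued WithZero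

variable {K : Type} [Field K] [Valued K ℤᵐ⁰]

/-! ## §1  Representatives modulo `U_E^{(2d−1)}` -/

/-- **`IsGlueRep σ ϖ d w u`** — `u` is a σ-FIXED UNIT REPRESENTATIVE of `w` modulo `U_E^{(2d−1)}`: `σ u = u`, `|u| = 1`, `|w − u| ≤ |ϖ|^{2d−1}` (the representative binder of
★ `…KappaSignDictionaryRecut` (R0)∕(R2): `hσu`, `hu`, `hbu`).  For `w ∈ {b, a, b∕a}` at a square datum such a `u` exists iff the axis depth `n_i ≥ 3d − 2` (REF5 R5-115 (2)).
[cite: Serre1979, Ch. V §3 Prop. 5, Cor. 3] -/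
def IsGlueRep (σ : K →+* K) (ϖ : K) (d : ℕ) (w u : K) : Prop :=
  σ u = u ∧ Valued.v u = 1 ∧ Valued.v (w - u) ≤ Valued.v ϖ ^ (2 * d - 1)

/-! ## §2  The glue sign `Ω` (OPTION A, junk `1`, choice-free) -/

open Classical in
/-- **THE GLUE SIGN `Ω(w) = glueSign σ ϖ d w ∈ {−1, 1}`** — the norm-residue sign `ω = normSign σ` of the `F`-GERM of `w` modulo `U_E^{(2d−1)}`: `−1` if `w` has a σ-fixed unit
representative modulo `U_E^{(2d−1)}` which is NOT a norm, `1` otherwise (i.e. if some∕every representative is a norm, OR — junk, never read — if `w` has no representative).  Well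
defined because two representatives differ by an element of `F ∩ U_E^{(2d−1)} = U_F^{(d)} ⊆ N(E^×)` (sequel `glueSign_eq_normSign`, over ★ `normSign_eq_of_near`).
[cite: Serre1979, Ch. V §3 Prop. 5, Cor. 3; Ch. XV §2] [cite: LanglandsShelstad1987, §3] -/
def glueSign (σ : K →+* K) (ϖ : K) (d : ℕ) (w : K) : ℤ :=
  if ∃ u : K, IsGlueRep σ ϖ d w u ∧ ¬ ∃ z : K, z * σ z = u then -1 else 1

/-! ## §3  The token of record `ΩR` at the square datum -/

/-- **THE Ω TOKEN OF RECORD `ΩR σ ϖ d a b i = glueSignR σ ϖ d a b i := Ω(![b, a, b∕a] i)`** — slot `i` of the square datum `(a, b)` (`l = (a, b, 1)`, `c_i = l_j ∕ l_k`,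
`{i, j, k} = {0, 1, 2}`: `c₀ = b`, `c₁ = a`, `c₂ = b∕a`; REF5 R5-115 (2) symmetric units).  The re-lettered κS children multiply today's sign token
`![ω(−1), ω(−1), 1] i · (baseSign σ i · ω(fPartProd δ ![a,b,1] i))` by this factor (SHAPE MEMO v1 §2). [cite: Rogawski1990, §4.10 p. 58] [cite: LanglandsShelstad1987, §3] -/
def glueSignR (σ : K →+* K) (ϖ : K) (d : ℕ) (a b : K) (i : Fin 3) : ℤ :=
  glueSign σ ϖ d ((![b, a, b / a] : Fin 3 → K) i)

/-! ## §4  Ties -/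

/-- Unfolding `IsGlueRep`, `Iff.rfl`. [cite: Serre1979, Ch. V §3 Cor. 3] -/
theorem isGlueRep_iff (σ : K →+* K) (ϖ : K) (d : ℕ) (w u : K) :
    IsGlueRep σ ϖ d w u ↔ σ u = u ∧ Valued.v u = 1 ∧ Valued.v (w - u) ≤ Valued.v ϖ ^ (2 * d - 1) := Iff.rfl

open Classical in
/-- Unfolding `glueSign`, `rfl`. [cite: Serre1979, Ch. XV §2] -/
theorem glueSign_eq (σ : K →+* K) (ϖ : K) (d : ℕ) (w : K) :
    glueSign σ ϖ d w = if ∃ u : K, IsGlueRep σ ϖ d w u ∧ ¬ ∃ z : K, z * σ z = u then -1 else 1 := rfl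

/-- Unfolding `glueSignR`, `rfl`. [cite: Rogawski1990, §4.10 p. 58] -/
theorem glueSignR_eq (σ : K →+* K) (ϖ : K) (d : ℕ) (a b : K) (i : Fin 3) : glueSignR σ ϖ d a b i = glueSign σ ϖ d ((![b, a, b / a] : Fin 3 → K) i) := rfl

/-- The slot table of `glueSignR`: `(Ω(b), Ω(a), Ω(b∕a))`. [cite: Rogawski1990, §4.10 p. 58] -/
theorem glueSignR_apply (σ : K →+* K) (ϖ : K) (d : ℕ) (a b : K) :
    glueSignR σ ϖ d a b 0 = glueSign σ ϖ d b ∧ glueSignR σ ϖ d a b 1 = glueSign σ ϖ d a ∧ glueSignR σ ϖ d a b 2 = glueSign σ ϖ d (b / a) :=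
  ⟨rfl, rfl, rfl⟩

/-- `glueSign ∈ {−1, 1}`. [cite: Serre1979, Ch. XV §2] -/
theorem glueSign_eq_one_or (σ : K →+* K) (ϖ : K) (d : ℕ) (w : K) : glueSign σ ϖ d w = 1 ∨ glueSign σ ϖ d w = -1 := by
  rw [glueSign_eq]
  split_ifs
  · exact Or.inr rfl
  · exact Or.inl rfl

/-- **NO REPRESENTATIVE ⟹ `Ω = 1`** (the junk convention of OPTION A; never read: on such an axis the amplitude vanishes, sequel `ampl_eq_zero_of_nonpos`). [cite: Serre1979, Ch. XV §2] -/
theorem glueSign_eq_one_of_not_exists (σ : K →+* K) (ϖ : K) (d : ℕ) (w : K) (h : ¬ ∃ u : K, IsGlueRep σ ϖ d w u) : glueSign σ ϖ d w = 1 := by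
  rw [glueSign_eq, if_neg]
  rintro ⟨u, hu, -⟩
  exact h ⟨u, hu⟩

/-- **A NON-NORM REPRESENTATIVE ⟹ `Ω = −1`** (definitional half; the converse «a norm representative ⟹ `Ω = 1`» needs the independence of the representative, sequel). [cite: Serre1979, Ch. XV §2] -/
theorem glueSign_eq_neg_one_of_rep_not_norm (σ : K →+* K) (ϖ : K) (d : ℕ) {w u : K} (hu : IsGlueRep σ ϖ d w u) (hn : ¬ ∃ z : K, z * σ z = u) :
    glueSign σ ϖ d w = -1 := by
  rw [glueSign_eq, if_pos ⟨u, hu, hn⟩]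

end Summit.HodgeConjecture.HodgeConjecture.Cruxes.H413.F0P3cDyRamDiagonalGlueSignDefs

end
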